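import Literature.AlgebraicGeometry.HodgeTheory.HodgeGenericTypeStabilityOfGenericPoint
import Literature.AlgebraicGeometry.HodgeTheory.AlgebraicMonodromyMumfordTate
import Literature.AlgebraicGeometry.FundamentalGroup.HypersurfaceComplementMeridians
import HarnessLib

/-!
# K1-B meridian package III — the rational monodromy representation on `π₁` (route `SignSymmetricPowers`,
# item stmt-HodgeConjecture-19716): conjugate loops have `Γ`-conjugate transports, loops normally
# generating `π₁` generate `Γ` up to conjugacy, transfer along a homeomorphism of the base

Helper file (`--supports stmt-HodgeConjecture-19716`) for the open stubs GEN (`stub_signMeridianGeneration`) and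
LINK (`stub_signConfluenceLinkG`) of the K1-B line `andre-zariski`: steps H4/H7 of memo K1B-GEN-STUBPLAN-g23 and
§3c of K1B-LINKF-PLAN-g23 — the dictionary between the fundamental group of the base and the rational monodromy
group `Γ_s = ratMonodromyGroup f k hU s` (`AlgebraicMonodromyMumfordTate`), for ANY family `f : 𝒳 ⟶ S`
cohomologically locally trivial over `U ⊆ S(ℂ)` whose transport preserves rational classes (`hrat`; for the
ι-even family: `isRationalClass_transportFun_familyM`).  No definition is introduced: the representation is an
existence statement.

* §1 `isRatTransport_unique`; **`exists_monodromyHom`** — there is `ρ : π₁(U, s) →* GL(Hᵏ(X_s; ℚ))` with `ρ c`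
  the rational transport along `c` and `ρ.range = Γ_s`; **`exists_conj_of_isConj`** — loops with conjugate
  classes in `π₁(U, s)` have `Γ_s`-conjugate rational transports (consumer of F-MC
  `affineHypersurfaceComplement_meridian_isConj`); **`ratMonodromyGroup_eq_closure_conj`** — if
  `normalClosure S = ⊤` in `π₁(U, s)` then `Γ_s` is generated by the `Γ_s`-conjugates of the transports along the
  loops of `S` (consumer of F-ZvK `affineHypersurfaceComplement_meridians_normalClosure_eq_top` — exactly the last
  two conjuncts of GEN).
* §2 `mapOfEq_surjective_of_homeomorph`, `normalClosure_image_mapOfEq_eq_top`, `mapOfEq_fromPath_mk` — moving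
  `normalClosure = ⊤`, conjugacy and loop classes along a homeomorphism of pointed bases (Mathlib
  `FundamentalGroup.mapOfEq`), to be used with the chart `S_M(ℂ) ≃ₜ affineHypersurfaceComplement h` of
  `SignSymmetricPowersMeridianChart`.

Sorry-free; axioms standard; no definition, no named fact.

## References

* [VoisinHodgeII2003] C. Voisin, Hodge Theory and Complex Algebraic Geometry II (CUP 2003), §3.1.2.
* [CarlsonMullerStachPeters2017] Carlson, Müller-Stach, Peters, Period Mappings and Period Domains, 2nd ed.,
  Lemma–Definition 15.3.7.
* [Deligne1974] P. Deligne, La conjecture de Weil I, Publ. Math. IHÉS 43 (1974), (5.2) and proof of (5.4).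
* [Shimada2010ZvK] I. Shimada, Lectures on Zariski–van Kampen theorem (arXiv:0906.1074), §3 Prop. 3.4.
-/

noncomputable section

set_option linter.dupNamespace false

open CategoryTheory Topology
open Literature.AlgebraicTopology.SingularHomology
open Literature.AlgebraicGeometry.Motives
open Literature.AlgebraicGeometry.HodgeTheory

namespace Summit.HodgeConjecture.HodgeConjecture.Theorems.SignSymmetricPowersMeridianMonodromy

/-! ### §1 The rational monodromy representation of a family on the fundamental group -/

section Family

variable {𝒳 S : SchemeOver ℂ} (f : 𝒳 ⟶ S) (k : ℕ) {U : Set (ComplexPoints S)}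
  (hU : IsCohomologicallyLocallyTrivialOn f U)

/-- Rational transport along a path class is unique (`Hᵏ(–; ℚ) ↪ Hᵏ(–; ℂ)`). [cite: VoisinHodgeII2003, §3.1.2] -/
theorem isRatTransport_unique {s t : U} {γ : Path.Homotopic.Quotient s t}
    {T T' : bettiCohomology (fiberOver f s.1) k ≃ₗ[ℚ] bettiCohomology (fiberOver f t.1) k}
    (hT : IsRatTransport f k hU γ T) (hT' : IsRatTransport f k hU γ T') : T = T' :=
  LinearEquiv.ext fun v => ofRatClass_injective k ((hT v).trans (hT' v).symm)

variable (hrat : ∀ (s t : U) (γ : Path.Homotopic.Quotient s t) (α : complexBetti (fiberOver f s.1) k),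
  IsRationalClass α → IsRationalClass (transportFun f k hU γ α))
include hrat

/-- **The rational monodromy representation** `ρ : π₁(U, s) →* GL(Hᵏ(X_s(ℂ); ℚ))` of a family whose
transport preserves rational classes: `ρ(c)` is the rational transport along the loop `c`, and the image of `ρ`
is the monodromy group `Γ_s = ratMonodromyGroup f k hU s`. (Existence statement; `ρ` is assembled from
`exists_ratTransport` by uniqueness.) [cite: VoisinHodgeII2003, §3.1.2] [cite: CarlsonMullerStachPeters2017, Lemma–Definition 15.3.7] -/
theorem exists_monodromyHom (s : U) :
    ∃ ρ : FundamentalGroup U s →* (bettiCohomology (fiberOver f s.1) k ≃ₗ[ℚ] bettiCohomology (fiberOver f s.1) k),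
      (∀ c, IsRatTransport f k hU (FundamentalGroup.toPath c) (ρ c)) ∧ ρ.range = ratMonodromyGroup f k hU s := by
  have hex : ∀ c : FundamentalGroup U s, ∃ T : bettiCohomology (fiberOver f s.1) k ≃ₗ[ℚ]
      bettiCohomology (fiberOver f s.1) k, IsRatTransport f k hU (FundamentalGroup.toPath c) T :=
    fun c => exists_ratTransport f k hU hrat _
  choose ρf hρf using hex
  refine ⟨{ toFun := ρf, map_one' := ?_, map_mul' := ?_ }, hρf, ?_⟩
  · exact isRatTransport_unique f k hU (hρf 1) (isRatTransport_refl f k hU s)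
  · intro a b
    apply isRatTransport_unique f k hU (hρf (a * b))
    rw [LinearEquiv.mul_eq_trans]
    exact (hρf b).trans f k hU (hρf a)
  · ext g
    constructor
    · rintro ⟨c, rfl⟩
      exact ⟨_, hρf c⟩
    · rintro ⟨γ, hγ⟩
      exact ⟨FundamentalGroup.fromPath γ, isRatTransport_unique f k hU (hρf _) hγ⟩

/-- **Conjugate loops have `Γ`-conjugate transports**: if the classes of two loops at `s` are conjugate in
`π₁(U, s)` and `T`, `T'` are the rational transports along them, then `T' = g T g⁻¹` for some `g` in the monodromy
group (the consumer of "meridians of one component are conjugate", `affineHypersurfaceComplement_meridian_isConj`).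
[cite: Deligne1974, proof of Thm. (5.4), p. 291] [cite: Shimada2010ZvK, §3 Prop. 3.4] -/
theorem exists_conj_of_isConj (s : U) {γ γ' : Path.Homotopic.Quotient s s}
    (hc : IsConj (FundamentalGroup.fromPath γ) (FundamentalGroup.fromPath γ'))
    {T T' : bettiCohomology (fiberOver f s.1) k ≃ₗ[ℚ] bettiCohomology (fiberOver f s.1) k}
    (hT : IsRatTransport f k hU γ T) (hT' : IsRatTransport f k hU γ' T') :
    ∃ g ∈ ratMonodromyGroup f k hU s, T' = g * T * g⁻¹ := by
  obtain ⟨ρ, hρ, hrange⟩ := exists_monodromyHom f k hU hrat s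
  obtain ⟨c, hcc⟩ := isConj_iff.1 hc
  have h1 : ρ (FundamentalGroup.fromPath γ) = T := isRatTransport_unique f k hU (hρ _) hT
  have h2 : ρ (FundamentalGroup.fromPath γ') = T' := isRatTransport_unique f k hU (hρ _) hT'
  refine ⟨ρ c, hrange ▸ ⟨c, rfl⟩, ?_⟩
  rw [← h2, ← hcc, map_mul, map_mul, map_inv, h1]

/-- **Loops normally generating `π₁` give generators of the monodromy group up to conjugacy**: if the normal
closure of `S ⊆ π₁(U, s)` is `π₁(U, s)` and `T c` is the rational transport along `c` for `c ∈ S`, then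
`Γ_s` is generated by the `Γ_s`-conjugates of the `T c`, `c ∈ S` (the consumer of Zariski–van Kampen,
`affineHypersurfaceComplement_meridians_normalClosure_eq_top`, via
`MonoidHom.range_eq_closure_conj_of_normalClosure_eq_top`). [cite: Shimada2010ZvK, §3 Prop. 3.4]
[cite: Deligne1974, (5.2)] -/
theorem ratMonodromyGroup_eq_closure_conj (s : U) {Sset : Set (FundamentalGroup U s)}
    (hS : Subgroup.normalClosure Sset = ⊤)
    (T : FundamentalGroup U s → (bettiCohomology (fiberOver f s.1) k ≃ₗ[ℚ] bettiCohomology (fiberOver f s.1) k))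
    (hT : ∀ c ∈ Sset, IsRatTransport f k hU (FundamentalGroup.toPath c) (T c)) :
    ratMonodromyGroup f k hU s = Subgroup.closure
      {x | ∃ g ∈ ratMonodromyGroup f k hU s, ∃ c ∈ Sset, x = g * T c * g⁻¹} := by
  obtain ⟨ρ, hρ, hrange⟩ := exists_monodromyHom f k hU hrat s
  have h := ρ.range_eq_closure_conj_of_normalClosure_eq_top hS
  rw [hrange] at h
  refine h.trans ?_
  congr 1
  ext x
  constructor
  · rintro ⟨g, hg, c, hc, rfl⟩
    exact ⟨g, hg, c, hc, by rw [isRatTransport_unique f k hU (hρ c) (hT c hc)]⟩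
  · rintro ⟨g, hg, c, hc, rfl⟩
    exact ⟨g, hg, c, hc, by rw [isRatTransport_unique f k hU (hρ c) (hT c hc)]⟩

end Family

/-! ### §2 Transfer along a homeomorphism of the base -/

section Transfer

variable {X Y : Type} [TopologicalSpace X] [TopologicalSpace Y]

/-- The map on fundamental groups induced by a homeomorphism is surjective (its inverse induces a section:
`e ∘ e⁻¹ ∘ γ = γ` pointwise). [folklore] -/
theorem mapOfEq_surjective_of_homeomorph (e : X ≃ₜ Y) {x : X} {y : Y} (h : e x = y) :
    Function.Surjective (FundamentalGroup.mapOfEq (e : C(X, Y)) h) := by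
  intro q
  have hx : e.symm y = x := by rw [← h, e.symm_apply_apply]
  induction q using Path.Homotopic.Quotient.ind with
  | mk γ =>
    refine ⟨FundamentalGroup.fromPath
      (Path.Homotopic.Quotient.mk ((γ.map e.symm.continuous).cast hx.symm hx.symm)), ?_⟩
    rw [FundamentalGroup.mapOfEq_apply]
    change ((Path.Homotopic.Quotient.mk ((γ.map e.symm.continuous).cast hx.symm hx.symm)).map
      (e : C(X, Y))).cast h.symm h.symm = Path.Homotopic.Quotient.mk γ
    rw [← Path.Homotopic.Quotient.mk_map, ← Path.Homotopic.Quotient.mk_cast]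
    congr 1
    ext t
    simp

/-- Transfer of "normal closure `= ⊤`" along a homeomorphism of pointed spaces. [folklore] -/
theorem normalClosure_image_mapOfEq_eq_top (e : X ≃ₜ Y) {x : X} {y : Y} (h : e x = y)
    {Sset : Set (FundamentalGroup X x)} (hS : Subgroup.normalClosure Sset = ⊤) :
    Subgroup.normalClosure (FundamentalGroup.mapOfEq (e : C(X, Y)) h '' Sset) = ⊤ := by
  have hsurj := mapOfEq_surjective_of_homeomorph e h
  rw [← Subgroup.map_normalClosure _ _ hsurj, hS, ← MonoidHom.range_eq_map, MonoidHom.range_eq_top.2 hsurj]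

/-- The image of the class of a loop under the map induced by a pointed continuous map is the class of the
image loop (with the endpoint cast). [folklore] -/
theorem mapOfEq_fromPath_mk (φ : C(X, Y)) {x : X} {y : Y} (h : φ x = y) (γ : Path x x) :
    FundamentalGroup.mapOfEq φ h (FundamentalGroup.fromPath (Path.Homotopic.Quotient.mk γ)) =
      FundamentalGroup.fromPath (Path.Homotopic.Quotient.mk ((γ.map φ.continuous).cast h.symm h.symm)) := by
  rw [FundamentalGroup.mapOfEq_apply]
  rfl

end Transfer

end Summit.HodgeConjecture.HodgeConjecture.Theorems.SignSymmetricPowersMeridianMonodromy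

end
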